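import Summits.Ventures.HodgeRepro.SingleClass

/-!
# Descent: an abelian single-class quadruple descends to a PRIMITIVE one on `G ⧸ rstab Φ`

Blind re-derivation cell `pub-hodge-repro`, seat `p1` (gen 10).  The converse of gen 9's `QuadPullback.lean`
(which pulls a quadruple BACK along a surjection): on an ABELIAN `(G, c)`, a single-class `SumTwo` quadruple of CM
types without a conjugate pair, `Φ, Φ g₁, Φ g₂, Φ g₃`, is the pull-back of a PRIMITIVE such quadruple on the
quotient `(G ⧸ rstab Φ, c̄)` — the image `π(Φ)` with the twists `π(g_i)`, `π : G → G ⧸ rstab Φ` (the typer's right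
stabiliser `rstab Φ` is normal since `G` is commutative, and `c ∉ rstab Φ` by `conj_not_mem_rstab`, so `c̄` is a
complex conjugation of the quotient).  Everything descends through ONE fact — `Φ` is saturated for its stabiliser
(`π x ∈ π(Φ) ⟺ x ∈ Φ`, `mk_mem_descend_iff`) — and the image is primitive because a stabilising `π h` stabilises `Φ`
itself.  With gen 9's pull-back this is the reduction «an instance exists on `(G, c)` iff a primitive instance exists
on some quotient `(G ⧸ N, c̄)`, `c ∉ N`», used by the Fourier arguments of P1.md §16d / §16g.

* `mk_mem_descend_iff`: `π x ∈ π(Φ) ↔ x ∈ Φ` (saturation);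
* `exists_primitive_descent`: the descent theorem (CM condition, primitivity, `SumTwo`, no conjugate pair).
-/

set_option autoImplicit false

open Finset
open scoped Pointwise

namespace HodgeRepro.Descent

variable {G : Type*} [CommGroup G]

/-- `Φ` is a union of cosets of its right stabiliser: `x ∈ Φ`, `n ∈ rstab Φ ⇒ x n ∈ Φ`. -/
theorem mul_mem_of_mem_rstab {Φ : Finset G} {x n : G} (hx : x ∈ Φ) (hn : n ∈ rstab Φ) : x * n ∈ Φ := by
  rw [mem_rstab] at hn
  rw [← hn]
  exact mul_mem_rmul hx

/-- The image of `Φ` in `G ⧸ rstab Φ`. -/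
def descend (Φ : Finset G) [DecidableEq (G ⧸ rstab Φ)] : Finset (G ⧸ rstab Φ) :=
  Φ.image (QuotientGroup.mk : G → G ⧸ rstab Φ)

/-- Saturation: `π x ∈ π(Φ) ↔ x ∈ Φ`. -/
theorem mk_mem_descend_iff (Φ : Finset G) [DecidableEq (G ⧸ rstab Φ)] (x : G) :
    (QuotientGroup.mk x : G ⧸ rstab Φ) ∈ descend Φ ↔ x ∈ Φ := by
  constructor
  · intro h
    obtain ⟨y, hy, hyx⟩ := Finset.mem_image.1 h
    have hn : y⁻¹ * x ∈ rstab Φ := QuotientGroup.eq.1 hyx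
    have := mul_mem_of_mem_rstab hy hn
    rwa [mul_inv_cancel_left] at this
  · intro h
    exact Finset.mem_image_of_mem _ h

/-- Membership in a twist of the image: `π x ∈ π(Φ) · π g ↔ x ∈ Φ g`. -/
theorem mk_mem_rmul_descend_iff (Φ : Finset G) [DecidableEq (G ⧸ rstab Φ)] (x g : G) :
    (QuotientGroup.mk x : G ⧸ rstab Φ) ∈ rmul (descend Φ) (QuotientGroup.mk g) ↔ x ∈ rmul Φ g := by
  rw [mem_rmul, mem_rmul, ← QuotientGroup.mk_inv, ← QuotientGroup.mk_mul, mk_mem_descend_iff]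

/-- The image of the complex conjugation is a complex conjugation of the quotient. -/
theorem isComplexConj_mk [DecidableEq G] [Fintype G] {c : G} (hc : IsComplexConj c) {Φ : Finset G} (hΦ : IsCMType c Φ) :
    IsComplexConj (QuotientGroup.mk c : G ⧸ rstab Φ) where
  ne_one := by
    intro h
    exact conj_not_mem_rstab hc hΦ ((QuotientGroup.eq_one_iff c).1 h)
  mul_self := by rw [← QuotientGroup.mk_mul, hc.mul_self, QuotientGroup.mk_one]
  comm := fun g => mul_comm _ g

/-- **Descent.**  On an abelian `(G, c)`, a single-class `SumTwo` quadruple of CM types without a conjugate pair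
descends to a PRIMITIVE one on `G ⧸ rstab Φ`: the image `π(Φ)` is a CM type for `π c`, primitive, its twists by
`π g_i` are `SumTwo`, and no two of them are complex conjugate. -/
theorem exists_primitive_descent [DecidableEq G] [Fintype G] {c : G} (hc : IsComplexConj c) {Φ : Finset G}
    (hΦ : IsCMType c Φ) {g : Fin 4 → G} (hs : SumTwo (fun i => rmul Φ (g i)))
    (hnc : ∀ i j : Fin 4, rmul Φ (g j) ≠ c • rmul Φ (g i)) [DecidableEq (G ⧸ rstab Φ)] :
    IsCMType (QuotientGroup.mk c) (descend Φ) ∧ IsPrimitive (descend Φ) ∧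
      SumTwo (fun i => rmul (descend Φ) (QuotientGroup.mk (g i))) ∧
      ∀ i j : Fin 4, rmul (descend Φ) (QuotientGroup.mk (g j)) ≠
        (QuotientGroup.mk c : G ⧸ rstab Φ) • rmul (descend Φ) (QuotientGroup.mk (g i)) := by
  have hc' := isComplexConj_mk hc hΦ
  refine ⟨?_, ?_, ?_, ?_⟩
  · -- CM type
    intro x'
    obtain ⟨x, rfl⟩ := QuotientGroup.mk_surjective x'
    rw [mk_mem_descend_iff, ← QuotientGroup.mk_mul, mk_mem_descend_iff]
    exact hΦ x
  · -- primitive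
    intro h' hh'
    obtain ⟨h, rfl⟩ := QuotientGroup.mk_surjective h'
    rw [QuotientGroup.eq_one_iff, mem_rstab]
    ext x
    rw [← mk_mem_rmul_descend_iff, hh', mk_mem_descend_iff]
  · -- SumTwo
    intro x'
    obtain ⟨x, rfl⟩ := QuotientGroup.mk_surjective x'
    refine Eq.trans ?_ (hs x)
    congr 1
    apply Finset.filter_congr
    intro i _
    exact mk_mem_rmul_descend_iff Φ x (g i)
  · -- no conjugate pair
    intro i j hij
    apply hnc i j
    ext x
    have := Finset.ext_iff.1 hij (QuotientGroup.mk x)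
    rw [mk_mem_rmul_descend_iff, hc'.mem_smul_iff, ← QuotientGroup.mk_mul, mk_mem_rmul_descend_iff] at this
    rw [this, hc.mem_smul_iff]

end HodgeRepro.Descent
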